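import Mathlib
import HarnessLib
import Summits.HubbardSuperconductivity.HubbardSuperconductivity.Theorems.KLProgrammeC4aUmkDirectTangencyLine
import Summits.HubbardSuperconductivity.HubbardSuperconductivity.Theorems.KLProgrammeC4aUmkDirectLayers

/-!
# Route `KLProgramme` — crux C4a, S3 brick (B4) «(U1)-HYBRID» B-1 (iii): THE DIRECT TANGENCY PART OF THE FIRST-ORDER LAYER, INTEGRATED — level lines (D-2c) × the
# `k = 0` layers (B-1 (ii)): `∫_{(0,2π]} |∫_{−hi}^{hi} wt(e) ∫_{−π}^{π} c·J·G·(K e)′(ē)| dϑ ≤ Λ_T·(2·2π(K₀ + P(1 + log⁺(M/π))) + 8π²W)`, `n`-FREE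

Cell `gate-hubbard-kl`, seat hubbard-kl-k3c3-p3 (g37; row «implicit-function / monotonicity route for μ(n)»).  Located brick for the (C)-closer lane / the `M₁`
assembly (stub (C) `stub_twoLeg_curvature` of `KLRegimeEngineV17F2`, stmt-HubbardSuperconductivity-20437), memo HOME/hubbard-kl-k3c3-p3/U1-CAUSTIC-SUP.md §19 (B-1)
call graph (b).

WHY.  `…C4aUmkDirectTangencyLine.directTangency_levelLine_abs_le` (D-2c) bounds the tangency part on one level line `e` at one relative angle `ϑ ∈ [−π,π] ∖ {0}` by
`(J₀(C₁ + C₂|e|/m + C₂|ρ|/m) + B_cJ₀ + J₁)·∫(max m |ē|)⁻¹` with the kernel scale `m`; with `m = max lo |e|` (`|e|/m ≤ 1`, `|ρ|/m ≤ |ρ|/lo`) this is the line-bound row of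
`…C4aUmkDirectLayers.setIntegral_abs_levelBox_le_of_lineBound` with `Λ_T = J₀(C₁ + C₂ + C₂|ρ|/lo) + B_cJ₀ + J₁`, at every `ϑ ∈ (0,2π) ∖ {π}` (angles in `(π, 2π)` by
`2π`-periodicity from `ϑ − 2π ∈ (−π, 0)`).  Kernel family `K e` with the envelopes of the umklapp ladder (U7): `(max |e| |u|)⁻¹`, `(max |e| |u|)⁻²` off the Fermi strip,
`(max lo |u|)⁻¹`, `(max lo |u|)⁻²` on it; cut-off family `c ϑ` (`C¹`, `|c| ≤ 1`, `|∂_v c| ≤ B_c`, `2π`-periodic, supported within `τ₂` of the direct caustic); Jacobian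
family `J e` (`|J| ≤ J₀`, `|∂_vJ| ≤ J₁`, periodic); weight `0 ≤ wt ≤ W` continuous on `[−hi, hi]`; `0 < lo ≤ hi ≤ hi₀` with the dominator data of
`…C4aAbsBubbleDominatorUpto.exists_absBubble_dominator_upto` (`a = −π`, `b = π`).
* **`directTangency_layers_abs_le`** (HEADLINE).
Sizes binder shape + `FrameOK` + `GeomConstants`; nothing asserts (C), K3 or superconductivity.
References: FST II CPAM 51 (1998) §3 [cite: FeldmanSalmhoferTrubowitz1998]; BGM 2006 §2.4 (2.36) [cite: BenfattoGiulianiMastropietro2006]; Salmhofer 1999 §4.5.3 [cite: Salmhofer1999].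
-/

noncomputable section

namespace Summit.HubbardSuperconductivity.HubbardSuperconductivity.Theorems.C4a

set_option linter.dupNamespace false -- summit = problem name (single-conjunct summit), D-0017

open Real Set Filter MeasureTheory intervalIntegral
open scoped Topology
open Literature.MathematicalPhysics.QuantumLattice Literature.MathematicalPhysics.QuantumLattice.BandSectorCounting Literature.Probability.LatticeModels
open Literature.MathematicalPhysics.QuantumLattice.FermiRG
open Summit.HubbardSuperconductivity.HubbardSuperconductivity.Theorems.KLRegimeSplit
open Summit.HubbardSuperconductivity.HubbardSuperconductivity.Theorems.DispersionFlow
open Summit.HubbardSuperconductivity.HubbardSuperconductivity.Theorems.PerturbedFermiCurve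

section Sizes

variable {K : TrigPolyC4v} {A : ℝ} (hA : ∀ p : Momentum, ∀ j ≤ 2, ‖iteratedFDeriv ℝ j (frameShift K) p‖ ≤ A) (hA20 : A ≤ 1 / 20)
  (hd : klCurveD ≤ (bandBounds (show (-4 : ℝ) < -1.1 by norm_num) (show (-1.1 : ℝ) ≤ -0.1 by norm_num) (show (-0.1 : ℝ) < 0 by norm_num)).Dtmin - 2 * A)
  {μ r : ℝ} (hr : 0 < r) (hlo : (-1.1 : ℝ) < μ - r - A) (hhi : μ + r + A < -0.1)
  {A₃ A₄ A₅ A₆ : ℝ} (hA₃ : ∀ p : Momentum, ‖iteratedFDeriv ℝ 3 (frameShift K) p‖ ≤ A₃)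
  (hA₄ : ∀ p : Momentum, ‖iteratedFDeriv ℝ 4 (frameShift K) p‖ ≤ A₄)
  (hA₅ : ∀ p : Momentum, ‖iteratedFDeriv ℝ 5 (frameShift K) p‖ ≤ A₅)
  (hA₆ : ∀ p : Momentum, ‖iteratedFDeriv ℝ 6 (frameShift K) p‖ ≤ A₆)
  {K₁ K₂ K₃ : ℝ} (hK₁ : ∀ p : Momentum, ‖fderiv ℝ (frameLevel μ K) p‖ ≤ K₁) (hK₂ : ∀ p : Momentum, ‖iteratedFDeriv ℝ 2 (frameLevel μ K) p‖ ≤ K₂)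
  (hK₃ : ∀ p : Momentum, ‖iteratedFDeriv ℝ 3 (frameLevel μ K) p‖ ≤ K₃)
include hA hA20 hd hr hlo hhi hA₃ hA₄ hA₅ hA₆ hK₁ hK₂ hK₃

/-- **THE DIRECT TANGENCY PART, INTEGRATED OVER LEVELS AND RELATIVE ANGLES** (HEADLINE; see the module docstring). [cite: FeldmanSalmhoferTrubowitz1998, §3 Thm 3.5] -/
theorem directTangency_layers_abs_le {R : RenConsts} {U : ℝ} {N : ℕ} (hF : FrameOK R U N μ K) {Kc r₀ g₀ w : ℝ} (hG : GeomConstants (frameLevel μ K) Kc r₀ g₀ w)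
    {W K₀ : ℝ}
    (hW : W * (2 * K₃ * msD A₃ A₄ 1 ^ 3 + 4 * K₂ * msD A₃ A₄ 1 * msD A₃ A₄ 2 + K₁ * msD A₃ A₄ 3) ≤ 3 / 200 * (bandBounds (show (-4 : ℝ) < -1.1 by norm_num) (show (-1.1 : ℝ) ≤ -0.1 by norm_num) (show (-0.1 : ℝ) < 0 by norm_num)).umin ^ 2)
    (hW0 : 0 ≤ W) (hK₀ : ∀ p : Momentum, |frameLevel μ K p| ≤ K₀)
    {ρ : ℝ} (hρ : |ρ| < r) (θ : ℝ) {κ τ₂ : ℝ} (hκ0 : 0 < κ) (hκ : κ ≤ (-μ - A - |ρ|) / (6 * π ^ 2) - A / 8 - A ^ 2 / (4 * (-μ - A - |ρ|)))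
    (hmargin : (|ρ| / 2 + ρ ^ 2 / (4 * (-μ - A - |ρ|)) + Kc * τ₂ / 2) / κ < (2 * (bandBounds (show (-4 : ℝ) < -1.1 by norm_num) (show (-1.1 : ℝ) ≤ -0.1 by norm_num) (show (-0.1 : ℝ) < 0 by norm_num)).umin / π * W) ^ 2)
    (hvW : π / (4 * (bandBounds (show (-4 : ℝ) < -1.1 by norm_num) (show (-1.1 : ℝ) ≤ -0.1 by norm_num) (show (-0.1 : ℝ) < 0 by norm_num)).umin) * (|ρ| / ((bandBounds (show (-4 : ℝ) < -1.1 by norm_num) (show (-1.1 : ℝ) ≤ -0.1 by norm_num) (show (-0.1 : ℝ) < 0 by norm_num)).Dtmin - 2 * A) + msD A₃ A₄ 1 * W + τ₂) ≤ W)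
    {hi₀ Kd P M lo hi Wt : ℝ} (hP : 0 ≤ P) (hWt : 0 ≤ Wt)
    (hdom : ∀ (hi ρ θ lo : ℝ) (t wt : ℝ → ℝ), 0 < hi → hi ≤ hi₀ → |ρ| < r → 0 < lo → lo ≤ hi → (∀ e ∈ Icc lo hi, e ≤ t e) →
      (∀ e ∈ Icc lo hi, 0 ≤ wt e) → (∀ e ∈ Icc lo hi, wt e ≤ Wt) → ∀ ϑ : ℝ, 0 < FermiRG.torusDist (ϑ - π) →
        (∫ e in lo..hi, wt e * ∫ x in Icc (-π) π, (max (t e) |frameLevel μ K (pairSumPath μ K ρ ϑ θ 0 - levelPoint μ K e (x + θ))|)⁻¹) ≤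
            Kd + P * log⁺ (M / FermiRG.torusDist (ϑ - π)) ∧
          (∫ e in lo..hi, wt e * ∫ x in Icc (-π) π, (max (t e) |frameLevel μ K (pairSumPath μ K ρ ϑ θ 0 - levelPoint μ K (-e) (x + θ))|)⁻¹) ≤
            Kd + P * log⁺ (M / FermiRG.torusDist (ϑ - π)))
    (hlo0 : 0 < lo) (hlohi : lo ≤ hi) (hhi₀ : hi ≤ hi₀) (hhir : hi < r) {wt : ℝ → ℝ}
    (hwc : ContinuousOn wt (Icc (-hi) hi)) (hw0 : ∀ e ∈ Icc (-hi) hi, 0 ≤ wt e) (hwW : ∀ e ∈ Icc (-hi) hi, wt e ≤ Wt)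
    {c J : ℝ → ℝ → ℝ} {Kr : ℝ → ℝ → ℝ} {Bc J₀ J₁ : ℝ}
    (hc : ∀ ϑ, ContDiff ℝ 1 (c ϑ)) (hcb : ∀ ϑ v, |c ϑ v| ≤ 1) (hc1 : ∀ ϑ v, |deriv (c ϑ) v| ≤ Bc) (hcper : ∀ ϑ v, c ϑ (v + 2 * π) = c ϑ v)
    (hcsupp : ∀ ϑ v, τ₂ ≤ ‖pairSumPath μ K ρ ϑ θ 0 - (2 : ℝ) • levelPoint μ K 0 (v + θ)‖ → c ϑ v = 0)
    (hJ : ∀ e ∈ Icc (-hi) hi, ContDiff ℝ 1 (J e)) (hJb : ∀ e ∈ Icc (-hi) hi, ∀ v, |J e v| ≤ J₀) (hJ1 : ∀ e ∈ Icc (-hi) hi, ∀ v, |deriv (J e) v| ≤ J₁)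
    (hJper : ∀ e ∈ Icc (-hi) hi, ∀ v, J e (v + 2 * π) = J e v)
    (hKd : ∀ e ∈ Icc (-hi) hi, ContDiff ℝ 1 (Kr e))
    (hK0 : ∀ e ∈ Icc (-hi) hi, e ≠ 0 → ∀ u, |Kr e u| ≤ (max |e| |u|)⁻¹) (hK0s : ∀ e ∈ Icc (-lo) lo, ∀ u, |Kr e u| ≤ (max lo |u|)⁻¹)
    (hK1 : ∀ e ∈ Icc (-hi) hi, e ≠ 0 → ∀ u, |deriv (Kr e) u| ≤ (max |e| |u|)⁻¹ ^ 2)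
    (hKs1 : ∀ e ∈ Icc (-lo) lo, ∀ u, |deriv (Kr e) u| ≤ (max lo |u|)⁻¹ ^ 2) :
    ∫ ϑ in Ioc 0 (2 * π), |∫ e in (-hi)..hi, wt e * ∫ v in (-π)..π,
        c ϑ v * J e v * ((fderiv ℝ (frameLevel μ K) (pairSumPath μ K ρ ϑ θ 0 - levelPoint μ K e (v + θ)))
          (iteratedDeriv 1 (levelPoint μ K 0) θ + iteratedDeriv 1 (levelPoint μ K ρ) (ϑ + θ)) *
          deriv (Kr e) (frameLevel μ K (pairSumPath μ K ρ ϑ θ 0 - levelPoint μ K e (v + θ))))| ≤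
      (J₀ * ((6 * (max (max K₀ K₁) (max K₂ K₃)) * (max 1 (max (4 * msD A₃ A₄ 1) (max (6 * msD A₃ A₄ 2) (10 * msD A₃ A₄ 3)))) ^ 3) / (2 * (3 / 400 * (bandBounds (show (-4 : ℝ) < -1.1 by norm_num) (show (-1.1 : ℝ) ≤ -0.1 by norm_num) (show (-0.1 : ℝ) < 0 by norm_num)).umin ^ 2)) + ((6 * (max (max K₀ K₁) (max K₂ K₃)) * (max 1 (max (4 * msD A₃ A₄ 1) (max (6 * msD A₃ A₄ 2) (10 * msD A₃ A₄ 3)))) ^ 3) / (2 * (3 / 400 * (bandBounds (show (-4 : ℝ) < -1.1 by norm_num) (show (-1.1 : ℝ) ≤ -0.1 by norm_num) (show (-0.1 : ℝ) < 0 by norm_num)).umin ^ 2)) * ((max (max K₀ K₁) (max K₂ K₃)) * max (1 / ((bandBounds (show (-4 : ℝ) < -1.1 by norm_num) (show (-1.1 : ℝ) ≤ -0.1 by norm_num) (show (-0.1 : ℝ) < 0 by norm_num)).Dtmin - 2 * A)) (radialRowOneConst A ((bandBounds (show (-4 : ℝ) < -1.1 by norm_num) (show (-1.1 : ℝ) ≤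 -0.1 by norm_num) (show (-0.1 : ℝ) < 0 by norm_num)).Dtmin - 2 * A))) + (1 + 1 : ℕ).factorial * (max (max K₀ K₁) (max K₂ K₃)) * max (1 / ((bandBounds (show (-4 : ℝ) < -1.1 by norm_num) (show (-1.1 : ℝ) ≤ -0.1 by norm_num) (show (-0.1 : ℝ) < 0 by norm_num)).Dtmin - 2 * A)) (radialRowOneConst A ((bandBounds (show (-4 : ℝ) < -1.1 by norm_num) (show (-1.1 : ℝ) ≤ -0.1 by norm_num) (show (-0.1 : ℝ) < 0 by norm_num)).Dtmin - 2 * A)) * (max 1 (3 * msD A₃ A₄ 1 + r * radialRowOneConst A ((bandBounds (show (-4 : ℝ) < -1.1 by norm_num) (show (-1.1 : ℝ) ≤ -0.1 by norm_num) (show (-0.1 : ℝ) < 0 by norm_num)).Dtmin - 2 * A))) ^ 1) + ((6 * (max (max K₀ K₁) (max K₂ K₃)) * (max 1 (max (4 * msD A₃ A₄ 1) (max (6 * msD A₃ A₄ 2) (10 * msD A₃ A₄ 3)))) ^ 3) / (2 * (3 / 400 * (bandBounds (show (-4 : ℝ) < -1.1 by norm_num) (show (-1.1 : ℝ) ≤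 -0.1 by norm_num) (show (-0.1 : ℝ) < 0 by norm_num)).umin ^ 2)) * ((max (max K₀ K₁) (max K₂ K₃)) * max (1 / ((bandBounds (show (-4 : ℝ) < -1.1 by norm_num) (show (-1.1 : ℝ) ≤ -0.1 by norm_num) (show (-0.1 : ℝ) < 0 by norm_num)).Dtmin - 2 * A)) (radialRowOneConst A ((bandBounds (show (-4 : ℝ) < -1.1 by norm_num) (show (-1.1 : ℝ) ≤ -0.1 by norm_num) (show (-0.1 : ℝ) < 0 by norm_num)).Dtmin - 2 * A))) + (1 + 1 : ℕ).factorial * (max (max K₀ K₁) (max K₂ K₃)) * max (1 / ((bandBounds (show (-4 : ℝ) < -1.1 by norm_num) (show (-1.1 : ℝ) ≤ -0.1 by norm_num) (show (-0.1 : ℝ) < 0 by norm_num)).Dtmin - 2 * A)) (radialRowOneConst A ((bandBounds (show (-4 : ℝ) < -1.1 by norm_num) (show (-1.1 : ℝ) ≤ -0.1 by norm_num) (show (-0.1 : ℝ) < 0 by norm_num)).Dtmin - 2 * A)) * (max 1 (3 * msD A₃ A₄ 1 + r * radialRowOneConst A ((bandBounds (show (-4 : ℝ) < -1.1 by norm_num)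 (show (-1.1 : ℝ) ≤ -0.1 by norm_num) (show (-0.1 : ℝ) < 0 by norm_num)).Dtmin - 2 * A))) ^ 1) * (|ρ| / lo)) + (Bc * J₀ + J₁)) *
        (2 * (2 * π * (Kd + P * (1 + log⁺ (M / π)))) + 2 * π * (4 * π * Wt)) := by
  set B := (bandBounds (show (-4 : ℝ) < -1.1 by norm_num) (show (-1.1 : ℝ) ≤ -0.1 by norm_num) (show (-0.1 : ℝ) < 0 by norm_num)) with hBdef
  set C₁ : ℝ := (6 * (max (max K₀ K₁) (max K₂ K₃)) * (max 1 (max (4 * msD A₃ A₄ 1) (max (6 * msD A₃ A₄ 2) (10 * msD A₃ A₄ 3)))) ^ 3) / (2 * (3 / 400 * (bandBounds (show (-4 : ℝ) < -1.1 by norm_num) (show (-1.1 : ℝ) ≤ -0.1 by norm_num) (show (-0.1 : ℝ) < 0 by norm_num)).umin ^ 2)) with hC₁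
  set C₂ : ℝ := ((6 * (max (max K₀ K₁) (max K₂ K₃)) * (max 1 (max (4 * msD A₃ A₄ 1) (max (6 * msD A₃ A₄ 2) (10 * msD A₃ A₄ 3)))) ^ 3) / (2 * (3 / 400 * (bandBounds (show (-4 : ℝ) < -1.1 by norm_num) (show (-1.1 : ℝ) ≤ -0.1 by norm_num) (show (-0.1 : ℝ) < 0 by norm_num)).umin ^ 2)) * ((max (max K₀ K₁) (max K₂ K₃)) * max (1 / ((bandBounds (show (-4 : ℝ) < -1.1 by norm_num) (show (-1.1 : ℝ) ≤ -0.1 by norm_num) (show (-0.1 : ℝ) < 0 by norm_num)).Dtmin - 2 * A)) (radialRowOneConst A ((bandBounds (show (-4 : ℝ) < -1.1 by norm_num) (show (-1.1 : ℝ) ≤ -0.1 by norm_num) (show (-0.1 : ℝ) < 0 by norm_num)).Dtmin - 2 * A))) + (1 + 1 : ℕ).factorial * (max (max K₀ K₁) (max K₂ K₃)) * max (1 / ((bandBounds (show (-4 : ℝ) < -1.1 by norm_num) (show (-1.1 : ℝ) ≤ -0.1 by norm_num) (show (-0.1 : ℝ) < 0 by norm_num)).Dtmin - 2 * A)) (radialRowOneConst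 A ((bandBounds (show (-4 : ℝ) < -1.1 by norm_num) (show (-1.1 : ℝ) ≤ -0.1 by norm_num) (show (-0.1 : ℝ) < 0 by norm_num)).Dtmin - 2 * A)) * (max 1 (3 * msD A₃ A₄ 1 + r * radialRowOneConst A ((bandBounds (show (-4 : ℝ) < -1.1 by norm_num) (show (-1.1 : ℝ) ≤ -0.1 by norm_num) (show (-0.1 : ℝ) < 0 by norm_num)).Dtmin - 2 * A))) ^ 1) with hC₂
  have hπ := Real.pi_pos
  have hADt : 2 * A < B.Dtmin := by have := klCurveD_pos; linarith only [this, hd]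
  have hDt : 0 < B.Dtmin - 2 * A := by linarith only [hADt]
  have hA0 : 0 ≤ A := le_trans (norm_nonneg _) (hA 0 0 (by norm_num))
  have hu : 0 < B.umin := B.umin_pos
  have h𝒦0 : 0 ≤ (max (max K₀ K₁) (max K₂ K₃)) := le_trans (le_trans (abs_nonneg _) (hK₀ 0)) ((le_max_left _ _).trans (le_max_left _ _))
  have hRR0 : 0 ≤ radialRowOneConst A (B.Dtmin - 2 * A) := radialRowOneConst_nonneg hA0 hDt
  have hRe0 : 0 ≤ max (1 / (B.Dtmin - 2 * A)) (radialRowOneConst A (B.Dtmin - 2 * A)) := le_trans (by positivity) (le_max_left _ _)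
  have hDD0 : 0 ≤ (max 1 (max (4 * msD A₃ A₄ 1) (max (6 * msD A₃ A₄ 2) (10 * msD A₃ A₄ 3)))) := zero_le_one.trans (le_max_left _ _)
  have hDe0 : 0 ≤ (max 1 (3 * msD A₃ A₄ 1 + r * radialRowOneConst A (B.Dtmin - 2 * A))) := zero_le_one.trans (le_max_left _ _)
  have hC₁0 : 0 ≤ C₁ := by rw [hC₁]; positivity
  have hC₂0 : 0 ≤ C₂ := by rw [hC₂]; positivity
  have hJ00 : 0 ≤ J₀ := (abs_nonneg _).trans (hJb hi ⟨by linarith, le_rfl⟩ 0)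
  have hBc0 : 0 ≤ Bc := (abs_nonneg _).trans (hc1 0 0)
  have hJ10 : 0 ≤ J₁ := (abs_nonneg _).trans (hJ1 hi ⟨by linarith, le_rfl⟩ 0)
  have hΛ : 0 ≤ J₀ * (C₁ + C₂ + C₂ * (|ρ| / lo)) + (Bc * J₀ + J₁) := by positivity
  refine setIntegral_abs_levelBox_le_of_lineBound hA hd hlo hhi hP hWt hdom θ hlo0 hlohi hhi₀ hhir hρ hwc hw0 hwW
    (X := fun ϑ e v => c ϑ v * J e v * (fderiv ℝ (frameLevel μ K) (pairSumPath μ K ρ ϑ θ 0 - levelPoint μ K e (v + θ)))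
      (iteratedDeriv 1 (levelPoint μ K 0) θ + iteratedDeriv 1 (levelPoint μ K ρ) (ϑ + θ))) (Kr := Kr) hΛ ?_ |>.trans_eq' ?_
  swap
  · refine setIntegral_congr_fun measurableSet_Ioc fun ϑ _ => ?_
    congr 1
    refine intervalIntegral.integral_congr fun e _ => ?_
    congr 1
    refine intervalIntegral.integral_congr fun v _ => ?_
    ring
  intro ϑ hϑI hϑπ e he
  -- the kernel scale of the line
  set m : ℝ := max lo |e| with hm
  have hm0 : 0 < m := lt_of_lt_of_le hlo0 (le_max_left _ _)
  have her : |e| < r := lt_of_le_of_lt (abs_le.2 ⟨he.1, he.2⟩) hhir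
  have hKm0 : ∀ u, |Kr e u| ≤ (max m |u|)⁻¹ := by
    intro u
    by_cases hes : |e| ≤ lo
    · have : m = lo := max_eq_left hes
      rw [this]; exact hK0s e (abs_le.1 hes) u
    · have hel : lo < |e| := lt_of_not_ge hes
      have : m = |e| := max_eq_right hel.le
      rw [this]; exact hK0 e he (abs_pos.1 (hlo0.trans hel)) u
  have hKm1 : ∀ u, |deriv (Kr e) u| ≤ (max m |u|)⁻¹ ^ 2 := by
    intro u
    by_cases hes : |e| ≤ lo
    · have : m = lo := max_eq_left hes
      rw [this]; exact hKs1 e (abs_le.1 hes) u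
    · have hel : lo < |e| := lt_of_not_ge hes
      have : m = |e| := max_eq_right hel.le
      rw [this]; exact hK1 e he (abs_pos.1 (hlo0.trans hel)) u
  -- the coefficient of the line at scale m is ≤ Λ
  have hcoef : J₀ * (C₁ + C₂ * (|e| / m) + C₂ * (|ρ| / m)) + (Bc * J₀ + J₁) ≤ J₀ * (C₁ + C₂ + C₂ * (|ρ| / lo)) + (Bc * J₀ + J₁) := by
    have h1 : |e| / m ≤ 1 := (div_le_one hm0).2 (le_max_right _ _)
    have h2 : |ρ| / m ≤ |ρ| / lo := div_le_div_of_nonneg_left (abs_nonneg _) hlo0 (le_max_left _ _)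
    have h1' : C₂ * (|e| / m) ≤ C₂ := by have := mul_le_mul_of_nonneg_left h1 hC₂0; rwa [mul_one] at this
    have h2' : C₂ * (|ρ| / m) ≤ C₂ * (|ρ| / lo) := mul_le_mul_of_nonneg_left h2 hC₂0
    have hprod := mul_le_mul_of_nonneg_left (add_le_add h1' h2') hJ00
    linarith [hprod]
  have hI0 : 0 ≤ ∫ v in (-π)..π, (max (max lo |e|) |frameLevel μ K (pairSumPath μ K ρ ϑ θ 0 - levelPoint μ K e (v + θ))|)⁻¹ :=
    intervalIntegral.integral_nonneg (by linarith) fun v _ => inv_nonneg.2 ((hlo0.le.trans (le_max_left _ _)).trans (le_max_left _ _))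
  -- the representative angle in `[−π, π] ∖ {0}`
  have key : ∀ ϑ' : ℝ, ϑ' ∈ Icc (-π) π → ϑ' ≠ 0 → pairSumPath μ K ρ ϑ' θ 0 = pairSumPath μ K ρ ϑ θ 0 →
      iteratedDeriv 1 (levelPoint μ K ρ) (ϑ' + θ) = iteratedDeriv 1 (levelPoint μ K ρ) (ϑ + θ) →
      |∫ v in (-π)..π, c ϑ v * J e v * (fderiv ℝ (frameLevel μ K) (pairSumPath μ K ρ ϑ θ 0 - levelPoint μ K e (v + θ)))
          (iteratedDeriv 1 (levelPoint μ K 0) θ + iteratedDeriv 1 (levelPoint μ K ρ) (ϑ + θ)) *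
          deriv (Kr e) (frameLevel μ K (pairSumPath μ K ρ ϑ θ 0 - levelPoint μ K e (v + θ)))| ≤
        (J₀ * (C₁ + C₂ + C₂ * (|ρ| / lo)) + (Bc * J₀ + J₁)) *
          ∫ v in (-π)..π, (max (max lo |e|) |frameLevel μ K (pairSumPath μ K ρ ϑ θ 0 - levelPoint μ K e (v + θ))|)⁻¹ := by
    intro ϑ' hϑ'I hϑ'0 hS hS'
    have hassoc : (∫ v in (-π)..π, c ϑ v * J e v * (fderiv ℝ (frameLevel μ K) (pairSumPath μ K ρ ϑ θ 0 - levelPoint μ K e (v + θ)))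
          (iteratedDeriv 1 (levelPoint μ K 0) θ + iteratedDeriv 1 (levelPoint μ K ρ) (ϑ + θ)) *
          deriv (Kr e) (frameLevel μ K (pairSumPath μ K ρ ϑ θ 0 - levelPoint μ K e (v + θ)))) =
        ∫ v in (-π)..π, c ϑ v * J e v * ((fderiv ℝ (frameLevel μ K) (pairSumPath μ K ρ ϑ θ 0 - levelPoint μ K e (v + θ)))
          (iteratedDeriv 1 (levelPoint μ K 0) θ + iteratedDeriv 1 (levelPoint μ K ρ) (ϑ + θ)) *
          deriv (Kr e) (frameLevel μ K (pairSumPath μ K ρ ϑ θ 0 - levelPoint μ K e (v + θ)))) :=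
      intervalIntegral.integral_congr fun v _ => by ring
    rw [hassoc]
    have h := directTangency_levelLine_abs_le hA hA20 hd hr hlo hhi hA₃ hA₄ hA₅ hA₆ hK₁ hK₂ hK₃ hF hG hW hW0 hK₀ hρ θ hκ0 hκ hmargin hvW hϑ'I hϑ'0 her
      (c := c ϑ) (J := J e) (Kr := Kr e) (hc ϑ) (hcb ϑ) (hc1 ϑ) (hcper ϑ) (fun v hv => hcsupp ϑ v (by rw [← hS]; exact hv)) (hJ e he) (hJb e he)
      (hJ1 e he) (hJper e he) (hKd e he) hm0 hKm0 hKm1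
    rw [hS, hS'] at h
    exact h.trans (mul_le_mul_of_nonneg_right hcoef hI0)
  rcases le_or_gt ϑ π with hle | hgt
  · exact key ϑ ⟨by linarith [hϑI.1], hle⟩ (ne_of_gt hϑI.1) rfl rfl
  · refine key (ϑ - 2 * π) ⟨by linarith, by linarith [hϑI.2]⟩ (by intro h; linarith [hϑI.2]) ?_ ?_
    · simp only [pairSumPath]
      have h := levelPoint_add_two_pi μ K ρ (ϑ - 2 * π + θ + 0)
      rw [show ϑ - 2 * π + θ + 0 + 2 * π = ϑ + θ + 0 by ring] at h
      rw [h]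
    · have h := iteratedDeriv_levelPoint_add_two_pi μ K ρ 1 (ϑ - 2 * π + θ)
      rw [show ϑ - 2 * π + θ + 2 * π = ϑ + θ by ring] at h
      exact h.symm

/-- **THE DIRECT TANGENCY PART, INTEGRATED — SEPARATE ANGLE WINDOWS** (the usable form: margin row on `Wϑ ≤ W`, loop-angle row
`(π/(4u))(|ρ|/(Dt−2A) + msD₁Wϑ + τ₂) ≤ W`, via `directTangency_levelLine_abs_le'`; the un-primed rows are infeasible for `W > 0` — located g37). [cite: FeldmanSalmhoferTrubowitz1998, §3 Thm 3.5] -/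
theorem directTangency_layers_abs_le' {R : RenConsts} {U : ℝ} {N : ℕ} (hF : FrameOK R U N μ K) {Kc r₀ g₀ w : ℝ} (hG : GeomConstants (frameLevel μ K) Kc r₀ g₀ w)
    {W K₀ : ℝ}
    (hW : W * (2 * K₃ * msD A₃ A₄ 1 ^ 3 + 4 * K₂ * msD A₃ A₄ 1 * msD A₃ A₄ 2 + K₁ * msD A₃ A₄ 3) ≤ 3 / 200 * (bandBounds (show (-4 : ℝ) < -1.1 by norm_num) (show (-1.1 : ℝ) ≤ -0.1 by norm_num) (show (-0.1 : ℝ) < 0 by norm_num)).umin ^ 2)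
    (hK₀ : ∀ p : Momentum, |frameLevel μ K p| ≤ K₀)
    {ρ : ℝ} (hρ : |ρ| < r) (θ : ℝ) {κ τ₂ Wϑ : ℝ} (hκ0 : 0 < κ) (hκ : κ ≤ (-μ - A - |ρ|) / (6 * π ^ 2) - A / 8 - A ^ 2 / (4 * (-μ - A - |ρ|)))
    (hWϑ0 : 0 ≤ Wϑ) (hWϑ : Wϑ ≤ W)
    (hmargin : (|ρ| / 2 + ρ ^ 2 / (4 * (-μ - A - |ρ|)) + Kc * τ₂ / 2) / κ < (2 * (bandBounds (show (-4 : ℝ) < -1.1 by norm_num) (show (-1.1 : ℝ) ≤ -0.1 by norm_num) (show (-0.1 : ℝ) < 0 by norm_num)).umin / π * Wϑ) ^ 2)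
    (hvW : π / (4 * (bandBounds (show (-4 : ℝ) < -1.1 by norm_num) (show (-1.1 : ℝ) ≤ -0.1 by norm_num) (show (-0.1 : ℝ) < 0 by norm_num)).umin) * (|ρ| / ((bandBounds (show (-4 : ℝ) < -1.1 by norm_num) (show (-1.1 : ℝ) ≤ -0.1 by norm_num) (show (-0.1 : ℝ) < 0 by norm_num)).Dtmin - 2 * A) + msD A₃ A₄ 1 * Wϑ + τ₂) ≤ W)
    {hi₀ Kd P M lo hi Wt : ℝ} (hP : 0 ≤ P) (hWt : 0 ≤ Wt)
    (hdom : ∀ (hi ρ θ lo : ℝ) (t wt : ℝ → ℝ), 0 < hi → hi ≤ hi₀ → |ρ| < r → 0 < lo → lo ≤ hi → (∀ e ∈ Icc lo hi, e ≤ t e) →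
      (∀ e ∈ Icc lo hi, 0 ≤ wt e) → (∀ e ∈ Icc lo hi, wt e ≤ Wt) → ∀ ϑ : ℝ, 0 < FermiRG.torusDist (ϑ - π) →
        (∫ e in lo..hi, wt e * ∫ x in Icc (-π) π, (max (t e) |frameLevel μ K (pairSumPath μ K ρ ϑ θ 0 - levelPoint μ K e (x + θ))|)⁻¹) ≤
            Kd + P * log⁺ (M / FermiRG.torusDist (ϑ - π)) ∧
          (∫ e in lo..hi, wt e * ∫ x in Icc (-π) π, (max (t e) |frameLevel μ K (pairSumPath μ K ρ ϑ θ 0 - levelPoint μ K (-e) (x + θ))|)⁻¹) ≤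
            Kd + P * log⁺ (M / FermiRG.torusDist (ϑ - π)))
    (hlo0 : 0 < lo) (hlohi : lo ≤ hi) (hhi₀ : hi ≤ hi₀) (hhir : hi < r) {wt : ℝ → ℝ}
    (hwc : ContinuousOn wt (Icc (-hi) hi)) (hw0 : ∀ e ∈ Icc (-hi) hi, 0 ≤ wt e) (hwW : ∀ e ∈ Icc (-hi) hi, wt e ≤ Wt)
    {c J : ℝ → ℝ → ℝ} {Kr : ℝ → ℝ → ℝ} {Bc J₀ J₁ : ℝ}
    (hc : ∀ ϑ, ContDiff ℝ 1 (c ϑ)) (hcb : ∀ ϑ v, |c ϑ v| ≤ 1) (hc1 : ∀ ϑ v, |deriv (c ϑ) v| ≤ Bc) (hcper : ∀ ϑ v, c ϑ (v + 2 * π) = c ϑ v)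
    (hcsupp : ∀ ϑ v, τ₂ ≤ ‖pairSumPath μ K ρ ϑ θ 0 - (2 : ℝ) • levelPoint μ K 0 (v + θ)‖ → c ϑ v = 0)
    (hJ : ∀ e ∈ Icc (-hi) hi, ContDiff ℝ 1 (J e)) (hJb : ∀ e ∈ Icc (-hi) hi, ∀ v, |J e v| ≤ J₀) (hJ1 : ∀ e ∈ Icc (-hi) hi, ∀ v, |deriv (J e) v| ≤ J₁)
    (hJper : ∀ e ∈ Icc (-hi) hi, ∀ v, J e (v + 2 * π) = J e v)
    (hKd : ∀ e ∈ Icc (-hi) hi, ContDiff ℝ 1 (Kr e))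
    (hK0 : ∀ e ∈ Icc (-hi) hi, e ≠ 0 → ∀ u, |Kr e u| ≤ (max |e| |u|)⁻¹) (hK0s : ∀ e ∈ Icc (-lo) lo, ∀ u, |Kr e u| ≤ (max lo |u|)⁻¹)
    (hK1 : ∀ e ∈ Icc (-hi) hi, e ≠ 0 → ∀ u, |deriv (Kr e) u| ≤ (max |e| |u|)⁻¹ ^ 2)
    (hKs1 : ∀ e ∈ Icc (-lo) lo, ∀ u, |deriv (Kr e) u| ≤ (max lo |u|)⁻¹ ^ 2) :
    ∫ ϑ in Ioc 0 (2 * π), |∫ e in (-hi)..hi, wt e * ∫ v in (-π)..π,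
        c ϑ v * J e v * ((fderiv ℝ (frameLevel μ K) (pairSumPath μ K ρ ϑ θ 0 - levelPoint μ K e (v + θ)))
          (iteratedDeriv 1 (levelPoint μ K 0) θ + iteratedDeriv 1 (levelPoint μ K ρ) (ϑ + θ)) *
          deriv (Kr e) (frameLevel μ K (pairSumPath μ K ρ ϑ θ 0 - levelPoint μ K e (v + θ))))| ≤
      (J₀ * ((6 * (max (max K₀ K₁) (max K₂ K₃)) * (max 1 (max (4 * msD A₃ A₄ 1) (max (6 * msD A₃ A₄ 2) (10 * msD A₃ A₄ 3)))) ^ 3) / (2 * (3 / 400 * (bandBounds (show (-4 : ℝ) < -1.1 by norm_num) (show (-1.1 : ℝ) ≤ -0.1 by norm_num) (show (-0.1 : ℝ) < 0 by norm_num)).umin ^ 2)) + ((6 * (max (max K₀ K₁) (max K₂ K₃)) * (max 1 (max (4 * msD A₃ A₄ 1) (max (6 * msD A₃ A₄ 2) (10 * msD A₃ A₄ 3)))) ^ 3) / (2 * (3 / 400 * (bandBounds (show (-4 : ℝ) < -1.1 by norm_num) (show (-1.1 : ℝ) ≤ -0.1 by norm_num) (show (-0.1 : ℝ) < 0 by norm_num)).umin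 ^ 2)) * ((max (max K₀ K₁) (max K₂ K₃)) * max (1 / ((bandBounds (show (-4 : ℝ) < -1.1 by norm_num) (show (-1.1 : ℝ) ≤ -0.1 by norm_num) (show (-0.1 : ℝ) < 0 by norm_num)).Dtmin - 2 * A)) (radialRowOneConst A ((bandBounds (show (-4 : ℝ) < -1.1 by norm_num) (show (-1.1 : ℝ) ≤ -0.1 by norm_num) (show (-0.1 : ℝ) < 0 by norm_num)).Dtmin - 2 * A))) + (1 + 1 : ℕ).factorial * (max (max K₀ K₁) (max K₂ K₃)) * max (1 / ((bandBounds (show (-4 : ℝ) < -1.1 by norm_num) (show (-1.1 : ℝ) ≤ -0.1 by norm_num) (show (-0.1 : ℝ) < 0 by norm_num)).Dtmin - 2 * A)) (radialRowOneConst A ((bandBounds (show (-4 : ℝ) < -1.1 by norm_num) (show (-1.1 : ℝ) ≤ -0.1 by norm_num) (show (-0.1 : ℝ) < 0 by norm_num)).Dtmin - 2 * A)) * (max 1 (3 * msD A₃ A₄ 1 + r * radialRowOneConst A ((bandBounds (show (-4 : ℝ) < -1.1 by norm_num) (show (-1.1 : ℝ) ≤ -0.1 by norm_num) (show (-0.1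 : ℝ) < 0 by norm_num)).Dtmin - 2 * A))) ^ 1) + ((6 * (max (max K₀ K₁) (max K₂ K₃)) * (max 1 (max (4 * msD A₃ A₄ 1) (max (6 * msD A₃ A₄ 2) (10 * msD A₃ A₄ 3)))) ^ 3) / (2 * (3 / 400 * (bandBounds (show (-4 : ℝ) < -1.1 by norm_num) (show (-1.1 : ℝ) ≤ -0.1 by norm_num) (show (-0.1 : ℝ) < 0 by norm_num)).umin ^ 2)) * ((max (max K₀ K₁) (max K₂ K₃)) * max (1 / ((bandBounds (show (-4 : ℝ) < -1.1 by norm_num) (show (-1.1 : ℝ) ≤ -0.1 by norm_num) (show (-0.1 : ℝ) < 0 by norm_num)).Dtmin - 2 * A)) (radialRowOneConst A ((bandBounds (show (-4 : ℝ) < -1.1 by norm_num) (show (-1.1 : ℝ) ≤ -0.1 by norm_num) (show (-0.1 : ℝ) < 0 by norm_num)).Dtmin - 2 * A))) + (1 + 1 : ℕ).factorial * (max (max K₀ K₁) (max K₂ K₃)) * max (1 / ((bandBounds (show (-4 : ℝ) < -1.1 by norm_num) (show (-1.1 : ℝ) ≤ -0.1 by norm_num) (show (-0.1 : ℝ) <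 0 by norm_num)).Dtmin - 2 * A)) (radialRowOneConst A ((bandBounds (show (-4 : ℝ) < -1.1 by norm_num) (show (-1.1 : ℝ) ≤ -0.1 by norm_num) (show (-0.1 : ℝ) < 0 by norm_num)).Dtmin - 2 * A)) * (max 1 (3 * msD A₃ A₄ 1 + r * radialRowOneConst A ((bandBounds (show (-4 : ℝ) < -1.1 by norm_num) (show (-1.1 : ℝ) ≤ -0.1 by norm_num) (show (-0.1 : ℝ) < 0 by norm_num)).Dtmin - 2 * A))) ^ 1) * (|ρ| / lo)) + (Bc * J₀ + J₁)) *
        (2 * (2 * π * (Kd + P * (1 + log⁺ (M / π)))) + 2 * π * (4 * π * Wt)) := by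
  set B := (bandBounds (show (-4 : ℝ) < -1.1 by norm_num) (show (-1.1 : ℝ) ≤ -0.1 by norm_num) (show (-0.1 : ℝ) < 0 by norm_num)) with hBdef
  set C₁ : ℝ := (6 * (max (max K₀ K₁) (max K₂ K₃)) * (max 1 (max (4 * msD A₃ A₄ 1) (max (6 * msD A₃ A₄ 2) (10 * msD A₃ A₄ 3)))) ^ 3) / (2 * (3 / 400 * (bandBounds (show (-4 : ℝ) < -1.1 by norm_num) (show (-1.1 : ℝ) ≤ -0.1 by norm_num) (show (-0.1 : ℝ) < 0 by norm_num)).umin ^ 2)) with hC₁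
  set C₂ : ℝ := ((6 * (max (max K₀ K₁) (max K₂ K₃)) * (max 1 (max (4 * msD A₃ A₄ 1) (max (6 * msD A₃ A₄ 2) (10 * msD A₃ A₄ 3)))) ^ 3) / (2 * (3 / 400 * (bandBounds (show (-4 : ℝ) < -1.1 by norm_num) (show (-1.1 : ℝ) ≤ -0.1 by norm_num) (show (-0.1 : ℝ) < 0 by norm_num)).umin ^ 2)) * ((max (max K₀ K₁) (max K₂ K₃)) * max (1 / ((bandBounds (show (-4 : ℝ) < -1.1 by norm_num) (show (-1.1 : ℝ) ≤ -0.1 by norm_num) (show (-0.1 : ℝ) < 0 by norm_num)).Dtmin - 2 * A)) (radialRowOneConst A ((bandBounds (show (-4 : ℝ) < -1.1 by norm_num) (show (-1.1 : ℝ) ≤ -0.1 by norm_num) (show (-0.1 : ℝ) < 0 by norm_num)).Dtmin - 2 * A))) + (1 + 1 : ℕ).factorial * (max (max K₀ K₁) (max K₂ K₃)) * max (1 / ((bandBounds (show (-4 : ℝ) < -1.1 by norm_num) (show (-1.1 : ℝ) ≤ -0.1 by norm_num) (show (-0.1 : ℝ) < 0 by norm_num)).Dtmin - 2 * A)) (radialRowOneConst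 A ((bandBounds (show (-4 : ℝ) < -1.1 by norm_num) (show (-1.1 : ℝ) ≤ -0.1 by norm_num) (show (-0.1 : ℝ) < 0 by norm_num)).Dtmin - 2 * A)) * (max 1 (3 * msD A₃ A₄ 1 + r * radialRowOneConst A ((bandBounds (show (-4 : ℝ) < -1.1 by norm_num) (show (-1.1 : ℝ) ≤ -0.1 by norm_num) (show (-0.1 : ℝ) < 0 by norm_num)).Dtmin - 2 * A))) ^ 1) with hC₂
  have hπ := Real.pi_pos
  have hADt : 2 * A < B.Dtmin := by have := klCurveD_pos; linarith only [this, hd]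
  have hDt : 0 < B.Dtmin - 2 * A := by linarith only [hADt]
  have hA0 : 0 ≤ A := le_trans (norm_nonneg _) (hA 0 0 (by norm_num))
  have hu : 0 < B.umin := B.umin_pos
  have h𝒦0 : 0 ≤ (max (max K₀ K₁) (max K₂ K₃)) := le_trans (le_trans (abs_nonneg _) (hK₀ 0)) ((le_max_left _ _).trans (le_max_left _ _))
  have hRR0 : 0 ≤ radialRowOneConst A (B.Dtmin - 2 * A) := radialRowOneConst_nonneg hA0 hDt
  have hRe0 : 0 ≤ max (1 / (B.Dtmin - 2 * A)) (radialRowOneConst A (B.Dtmin - 2 * A)) := le_trans (by positivity) (le_max_left _ _)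
  have hDD0 : 0 ≤ (max 1 (max (4 * msD A₃ A₄ 1) (max (6 * msD A₃ A₄ 2) (10 * msD A₃ A₄ 3)))) := zero_le_one.trans (le_max_left _ _)
  have hDe0 : 0 ≤ (max 1 (3 * msD A₃ A₄ 1 + r * radialRowOneConst A (B.Dtmin - 2 * A))) := zero_le_one.trans (le_max_left _ _)
  have hC₁0 : 0 ≤ C₁ := by rw [hC₁]; positivity
  have hC₂0 : 0 ≤ C₂ := by rw [hC₂]; positivity
  have hJ00 : 0 ≤ J₀ := (abs_nonneg _).trans (hJb hi ⟨by linarith, le_rfl⟩ 0)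
  have hBc0 : 0 ≤ Bc := (abs_nonneg _).trans (hc1 0 0)
  have hJ10 : 0 ≤ J₁ := (abs_nonneg _).trans (hJ1 hi ⟨by linarith, le_rfl⟩ 0)
  have hΛ : 0 ≤ J₀ * (C₁ + C₂ + C₂ * (|ρ| / lo)) + (Bc * J₀ + J₁) := by positivity
  refine setIntegral_abs_levelBox_le_of_lineBound hA hd hlo hhi hP hWt hdom θ hlo0 hlohi hhi₀ hhir hρ hwc hw0 hwW
    (X := fun ϑ e v => c ϑ v * J e v * (fderiv ℝ (frameLevel μ K) (pairSumPath μ K ρ ϑ θ 0 - levelPoint μ K e (v + θ)))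
      (iteratedDeriv 1 (levelPoint μ K 0) θ + iteratedDeriv 1 (levelPoint μ K ρ) (ϑ + θ))) (Kr := Kr) hΛ ?_ |>.trans_eq' ?_
  swap
  · refine setIntegral_congr_fun measurableSet_Ioc fun ϑ _ => ?_
    congr 1
    refine intervalIntegral.integral_congr fun e _ => ?_
    congr 1
    refine intervalIntegral.integral_congr fun v _ => ?_
    ring
  intro ϑ hϑI hϑπ e he
  -- the kernel scale of the line
  set m : ℝ := max lo |e| with hm
  have hm0 : 0 < m := lt_of_lt_of_le hlo0 (le_max_left _ _)
  have her : |e| < r := lt_of_le_of_lt (abs_le.2 ⟨he.1, he.2⟩) hhir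
  have hKm0 : ∀ u, |Kr e u| ≤ (max m |u|)⁻¹ := by
    intro u
    by_cases hes : |e| ≤ lo
    · have : m = lo := max_eq_left hes
      rw [this]; exact hK0s e (abs_le.1 hes) u
    · have hel : lo < |e| := lt_of_not_ge hes
      have : m = |e| := max_eq_right hel.le
      rw [this]; exact hK0 e he (abs_pos.1 (hlo0.trans hel)) u
  have hKm1 : ∀ u, |deriv (Kr e) u| ≤ (max m |u|)⁻¹ ^ 2 := by
    intro u
    by_cases hes : |e| ≤ lo
    · have : m = lo := max_eq_left hes
      rw [this]; exact hKs1 e (abs_le.1 hes) u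
    · have hel : lo < |e| := lt_of_not_ge hes
      have : m = |e| := max_eq_right hel.le
      rw [this]; exact hK1 e he (abs_pos.1 (hlo0.trans hel)) u
  -- the coefficient of the line at scale m is ≤ Λ
  have hcoef : J₀ * (C₁ + C₂ * (|e| / m) + C₂ * (|ρ| / m)) + (Bc * J₀ + J₁) ≤ J₀ * (C₁ + C₂ + C₂ * (|ρ| / lo)) + (Bc * J₀ + J₁) := by
    have h1 : |e| / m ≤ 1 := (div_le_one hm0).2 (le_max_right _ _)
    have h2 : |ρ| / m ≤ |ρ| / lo := div_le_div_of_nonneg_left (abs_nonneg _) hlo0 (le_max_left _ _)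
    have h1' : C₂ * (|e| / m) ≤ C₂ := by have := mul_le_mul_of_nonneg_left h1 hC₂0; rwa [mul_one] at this
    have h2' : C₂ * (|ρ| / m) ≤ C₂ * (|ρ| / lo) := mul_le_mul_of_nonneg_left h2 hC₂0
    have hprod := mul_le_mul_of_nonneg_left (add_le_add h1' h2') hJ00
    linarith [hprod]
  have hI0 : 0 ≤ ∫ v in (-π)..π, (max (max lo |e|) |frameLevel μ K (pairSumPath μ K ρ ϑ θ 0 - levelPoint μ K e (v + θ))|)⁻¹ :=
    intervalIntegral.integral_nonneg (by linarith) fun v _ => inv_nonneg.2 ((hlo0.le.trans (le_max_left _ _)).trans (le_max_left _ _))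
  -- the representative angle in `[−π, π] ∖ {0}`
  have key : ∀ ϑ' : ℝ, ϑ' ∈ Icc (-π) π → ϑ' ≠ 0 → pairSumPath μ K ρ ϑ' θ 0 = pairSumPath μ K ρ ϑ θ 0 →
      iteratedDeriv 1 (levelPoint μ K ρ) (ϑ' + θ) = iteratedDeriv 1 (levelPoint μ K ρ) (ϑ + θ) →
      |∫ v in (-π)..π, c ϑ v * J e v * (fderiv ℝ (frameLevel μ K) (pairSumPath μ K ρ ϑ θ 0 - levelPoint μ K e (v + θ)))
          (iteratedDeriv 1 (levelPoint μ K 0) θ + iteratedDeriv 1 (levelPoint μ K ρ) (ϑ + θ)) *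
          deriv (Kr e) (frameLevel μ K (pairSumPath μ K ρ ϑ θ 0 - levelPoint μ K e (v + θ)))| ≤
        (J₀ * (C₁ + C₂ + C₂ * (|ρ| / lo)) + (Bc * J₀ + J₁)) *
          ∫ v in (-π)..π, (max (max lo |e|) |frameLevel μ K (pairSumPath μ K ρ ϑ θ 0 - levelPoint μ K e (v + θ))|)⁻¹ := by
    intro ϑ' hϑ'I hϑ'0 hS hS'
    have hassoc : (∫ v in (-π)..π, c ϑ v * J e v * (fderiv ℝ (frameLevel μ K) (pairSumPath μ K ρ ϑ θ 0 - levelPoint μ K e (v + θ)))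
          (iteratedDeriv 1 (levelPoint μ K 0) θ + iteratedDeriv 1 (levelPoint μ K ρ) (ϑ + θ)) *
          deriv (Kr e) (frameLevel μ K (pairSumPath μ K ρ ϑ θ 0 - levelPoint μ K e (v + θ)))) =
        ∫ v in (-π)..π, c ϑ v * J e v * ((fderiv ℝ (frameLevel μ K) (pairSumPath μ K ρ ϑ θ 0 - levelPoint μ K e (v + θ)))
          (iteratedDeriv 1 (levelPoint μ K 0) θ + iteratedDeriv 1 (levelPoint μ K ρ) (ϑ + θ)) *
          deriv (Kr e) (frameLevel μ K (pairSumPath μ K ρ ϑ θ 0 - levelPoint μ K e (v + θ)))) :=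
      intervalIntegral.integral_congr fun v _ => by ring
    rw [hassoc]
    have h := directTangency_levelLine_abs_le' hA hA20 hd hr hlo hhi hA₃ hA₄ hA₅ hA₆ hK₁ hK₂ hK₃ hF hG hW hK₀ hρ θ hκ0 hκ hWϑ0 hWϑ hmargin hvW hϑ'I hϑ'0 her
      (c := c ϑ) (J := J e) (Kr := Kr e) (hc ϑ) (hcb ϑ) (hc1 ϑ) (hcper ϑ) (fun v hv => hcsupp ϑ v (by rw [← hS]; exact hv)) (hJ e he) (hJb e he)
      (hJ1 e he) (hJper e he) (hKd e he) hm0 hKm0 hKm1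
    rw [hS, hS'] at h
    exact h.trans (mul_le_mul_of_nonneg_right hcoef hI0)
  rcases le_or_gt ϑ π with hle | hgt
  · exact key ϑ ⟨by linarith [hϑI.1], hle⟩ (ne_of_gt hϑI.1) rfl rfl
  · refine key (ϑ - 2 * π) ⟨by linarith, by linarith [hϑI.2]⟩ (by intro h; linarith [hϑI.2]) ?_ ?_
    · simp only [pairSumPath]
      have h := levelPoint_add_two_pi μ K ρ (ϑ - 2 * π + θ + 0)
      rw [show ϑ - 2 * π + θ + 0 + 2 * π = ϑ + θ + 0 by ring] at h
      rw [h]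
    · have h := iteratedDeriv_levelPoint_add_two_pi μ K ρ 1 (ϑ - 2 * π + θ)
      rw [show ϑ - 2 * π + θ + 2 * π = ϑ + θ by ring] at h
      exact h.symm

end Sizes

end Summit.HubbardSuperconductivity.HubbardSuperconductivity.Theorems.C4a

end
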